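import Summits.ValiantsHypothesis.ValiantsHypothesis.Theorems.BarrierLeverPartitionMinorsHitByVPAnchoredDoor
import Summits.ValiantsHypothesis.ValiantsHypothesis.Theorems.BarrierLeverPartitionMinorsHitByVPCubeBall

/-!
# Route BarrierLever — item `PartitionMinorsHitByVP` (stmt-ValiantsHypothesis-19717):
# the anchored door is ALIVE on cube-versus-Hamming-ball at every height

Helper file (`--supports stmt-ValiantsHypothesis-19717`; cell valiant-natproofs, rung V4, 𝒟-side door (c);
prover seat val-np-p1 gen 14). Closes NO item.

`anchoredDoor_eq_witness`: with the 0/1 anchor weights `cubeBallTheta k` (weight `1` on the anchors `(x_a | y_a)`, `a < 2k`,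
and `(x_{2j} x_{2j+1} | y_d)`, `d ∈ Y_j`; all twists `0`) the anchored door `AnchoredDoor.anchoredDoor` (p573694) IS the
cube-versus-ball witness `CubeBall.witness k k` (p567651). Hence (`anchoredDoor_hits_cubeBall`) the hypothesis of
`AnchoredDoor.partitionMinorsHitByVP_of_anchored` holds on every cube-versus-ball layout (`h = 2k+1`, rows = subsets of the
first `2k` `x`-vertices, columns ⊇ the `y`-ball of radius `k`): the door of the anchored-peeling line is alive on the cell's
stress family at every height (`CubeBall.det_cubeBall_witness_ne_zero`, hard Lefschetz).

WHAT THIS IS NOT: one layout family; nothing on crux stmt-ValiantsHypothesis-14610 or `VP` versus `VNP`.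
-/

set_option linter.dupNamespace false

namespace Summit.ValiantsHypothesis.ValiantsHypothesis.Theorems.BarrierLever.AnchoredDoor

open Finset MvPolynomial
open Summit.ValiantsHypothesis.ValiantsHypothesis.Theorems.BarrierLever.BrickCalculus
open Summit.ValiantsHypothesis.ValiantsHypothesis.Theorems.BarrierLever.CubeBall

noncomputable section

variable {k : ℕ}

open Classical in
/-- The 0/1 anchor weights of the cube-versus-ball witness: `1` on `(x_a | y_a)` for `a ∈ X_k` and on
`(x_{2j}x_{2j+1} | y_d)` for `j < k`, `d ∈ Y_j`; `0` elsewhere. -/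
def cubeBallTheta (k : ℕ) (A B : Finset (Fin (2 * k + 1))) : ℂ :=
  if (∃ a ∈ xSet k k, A = {a} ∧ B = {a}) ∨
     (∃ j ∈ Finset.range k, A = {vtx k (2 * j), vtx k (2 * j + 1)} ∧ ∃ d ∈ ySet k j, B = {d}) then 1 else 0

/-- An anchor factor with trivial twists is `1` or a weight-one brick. -/
theorem anchorTerm_zero_twist (θ : Finset (Fin (2 * k + 1)) → Finset (Fin (2 * k + 1)) → ℂ)
    (A B : Finset (Fin (2 * k + 1))) :
    anchorTerm θ (fun _ _ _ => 0) (fun _ _ _ => 0) A B =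
      1 + C (θ A B) * (∏ a ∈ A, X (Fin.castAdd (2 * k + 1) a)) * (∏ c ∈ B, X (Fin.natAdd (2 * k + 1) c)) := by
  rw [anchorTerm]
  simp only [map_zero, zero_mul, add_zero, Finset.prod_const_one, mul_one]

/-- With the 0/1 weights: a selected anchor gives its brick, any other anchor gives `1`. -/
theorem anchorTerm_cubeBallTheta (k : ℕ) (A B : Finset (Fin (2 * k + 1))) :
    anchorTerm (cubeBallTheta k) (fun _ _ _ => 0) (fun _ _ _ => 0) A B =
      if (∃ a ∈ xSet k k, A = {a} ∧ B = {a}) ∨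
         (∃ j ∈ Finset.range k, A = {vtx k (2 * j), vtx k (2 * j + 1)} ∧ ∃ d ∈ ySet k j, B = {d})
      then brick A B else 1 := by
  classical
  rw [anchorTerm_zero_twist, cubeBallTheta]
  split_ifs with hsel
  · rfl
  · rw [map_zero, zero_mul, zero_mul, add_zero]

/-- The witness as a product over `range`. -/
theorem witness_eq_prod (k j : ℕ) : witness k j = ∏ i ∈ Finset.range j, blockW k i := by
  induction j with
  | zero => rw [witness, Finset.range_zero, Finset.prod_empty]
  | succ j ih => rw [witness_succ, ih, Finset.prod_range_succ]

/-- Products over `range (2k)` split into even and odd indices. -/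
theorem prod_range_two_mul {M : Type*} [CommMonoid M] (f : ℕ → M) (k : ℕ) :
    ∏ i ∈ Finset.range (2 * k), f i = ∏ j ∈ Finset.range k, (f (2 * j) * f (2 * j + 1)) := by
  induction k with
  | zero => simp
  | succ k ih =>
    rw [show 2 * (k + 1) = 2 * k + 1 + 1 by ring, Finset.prod_range_succ, Finset.prod_range_succ, ih,
      Finset.prod_range_succ, mul_assoc]

/-- The vertex anchors of the 0/1 weights multiply to `∏_{a ∈ X_k} (1 + x_a y_a)`. -/
theorem prod_vertexAnchors (k : ℕ) :
    (∏ a : Fin (2 * k + 1), ∏ c : Fin (2 * k + 1),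
      anchorTerm (cubeBallTheta k) (fun _ _ _ => 0) (fun _ _ _ => 0) {a} {c}) =
      ∏ a ∈ xSet k k, brick {a} {a} := by
  classical
  have hsel : ∀ a c : Fin (2 * k + 1),
      ((∃ a' ∈ xSet k k, ({a} : Finset (Fin (2 * k + 1))) = {a'} ∧ ({c} : Finset (Fin (2 * k + 1))) = {a'}) ∨
       (∃ j ∈ Finset.range k, ({a} : Finset (Fin (2 * k + 1))) = {vtx k (2 * j), vtx k (2 * j + 1)} ∧
         ∃ d ∈ ySet k j, ({c} : Finset (Fin (2 * k + 1))) = {d})) ↔ (a ∈ xSet k k ∧ c = a) := by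
    intro a c
    constructor
    · rintro (⟨a', ha', h1, h2⟩ | ⟨j, hj, h1, -⟩)
      · rw [Finset.singleton_inj] at h1 h2
        exact ⟨h1 ▸ ha', h2.trans h1.symm⟩
      · exfalso
        have hj' : j < k := Finset.mem_range.mp hj
        have := congrArg Finset.card h1
        rw [Finset.card_singleton, Finset.card_pair (vtx_two_mul_ne hj')] at this
        exact absurd this (by norm_num)
    · rintro ⟨ha, rfl⟩
      exact Or.inl ⟨c, ha, rfl, rfl⟩
  calc _ = ∏ a : Fin (2 * k + 1), (if a ∈ xSet k k then brick {a} {a} else 1) := by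
        refine Finset.prod_congr rfl (fun a _ => ?_)
        calc _ = ∏ c : Fin (2 * k + 1), (if a ∈ xSet k k ∧ c = a then brick {a} {c} else 1) := by
              refine Finset.prod_congr rfl (fun c _ => ?_)
              rw [anchorTerm_cubeBallTheta]
              exact if_congr (hsel a c) rfl rfl
          _ = if a ∈ xSet k k then brick {a} {a} else 1 := by
              by_cases ha : a ∈ xSet k k
              · simp only [ha, true_and, if_true]
                rw [Finset.prod_ite_eq' Finset.univ a (fun c => brick {a} {c}), if_pos (Finset.mem_univ _)]
              · simp [ha]
    _ = ∏ a ∈ xSet k k, brick {a} {a} := by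
        rw [← Finset.prod_filter, Finset.filter_mem_eq_inter, Finset.univ_inter]

/-- The vertex–pair anchors of the 0/1 weights are all trivial. -/
theorem prod_vertexPairAnchors (k : ℕ) :
    (∏ a : Fin (2 * k + 1), ∏ B ∈ Finset.powersetCard 2 (Finset.univ : Finset (Fin (2 * k + 1))),
      anchorTerm (cubeBallTheta k) (fun _ _ _ => 0) (fun _ _ _ => 0) {a} B) = 1 := by
  classical
  refine Finset.prod_eq_one (fun a _ => Finset.prod_eq_one (fun B hB => ?_))
  rw [anchorTerm_cubeBallTheta, if_neg]
  have hB2 : B.card = 2 := (Finset.mem_powersetCard.mp hB).2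
  rintro (⟨a', -, -, h2⟩ | ⟨j, hj, h1, -⟩)
  · rw [h2, Finset.card_singleton] at hB2; exact absurd hB2 (by norm_num)
  · have := congrArg Finset.card h1
    rw [Finset.card_singleton, Finset.card_pair (vtx_two_mul_ne (Finset.mem_range.mp hj))] at this
    exact absurd this (by norm_num)

/-- The pair–vertex anchors of the 0/1 weights multiply to the fans `∏_{j<k} ∏_{d ∈ Y_j} (1 + x_{2j}x_{2j+1} y_d)`. -/
theorem prod_pairAnchors (k : ℕ) :
    (∏ A ∈ Finset.powersetCard 2 (Finset.univ : Finset (Fin (2 * k + 1))), ∏ c : Fin (2 * k + 1),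
      anchorTerm (cubeBallTheta k) (fun _ _ _ => 0) (fun _ _ _ => 0) A {c}) =
      ∏ j ∈ Finset.range k, ∏ d ∈ ySet k j, brick {vtx k (2 * j), vtx k (2 * j + 1)} {d} := by
  classical
  -- the pair map `j ↦ {x_{2j}, x_{2j+1}}` is injective on `range k`
  set pr : ℕ → Finset (Fin (2 * k + 1)) := fun j => {vtx k (2 * j), vtx k (2 * j + 1)} with hpr
  have hinj : Set.InjOn pr ↑(Finset.range k) := by
    intro j hj j' hj' hjj
    have hjk : j < k := Finset.mem_range.mp hj
    have hjk' : j' < k := Finset.mem_range.mp hj'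
    have hmem : vtx k (2 * j) ∈ pr j' := by rw [← hjj]; exact Finset.mem_insert_self _ _
    rcases Finset.mem_insert.mp hmem with h1 | h1
    · have := vtx_inj (by omega) (by omega) h1; omega
    · have := vtx_inj (by omega) (by omega) (Finset.mem_singleton.mp h1); omega
  have hsel : ∀ A : Finset (Fin (2 * k + 1)), ∀ c : Fin (2 * k + 1),
      ((∃ a' ∈ xSet k k, A = {a'} ∧ ({c} : Finset (Fin (2 * k + 1))) = {a'}) ∨
       (∃ j ∈ Finset.range k, A = pr j ∧ ∃ d ∈ ySet k j, ({c} : Finset (Fin (2 * k + 1))) = {d})) →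
      A.card = 2 → ∃ j ∈ Finset.range k, A = pr j ∧ c ∈ ySet k j := by
    intro A c hA hA2
    rcases hA with ⟨a', -, h1, -⟩ | ⟨j, hj, h1, d, hd, h2⟩
    · rw [h1, Finset.card_singleton] at hA2; exact absurd hA2 (by norm_num)
    · exact ⟨j, hj, h1, by rwa [Finset.singleton_inj.mp h2]⟩
  -- inner products
  have hinner : ∀ A ∈ Finset.powersetCard 2 (Finset.univ : Finset (Fin (2 * k + 1))),
      (∏ c : Fin (2 * k + 1), anchorTerm (cubeBallTheta k) (fun _ _ _ => 0) (fun _ _ _ => 0) A {c}) =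
        if h : ∃ j ∈ Finset.range k, A = pr j then ∏ d ∈ ySet k (Classical.choose h), brick A {d} else 1 := by
    intro A hA
    have hA2 : A.card = 2 := (Finset.mem_powersetCard.mp hA).2
    by_cases hex : ∃ j ∈ Finset.range k, A = pr j
    · rw [dif_pos hex]
      obtain ⟨hj₀, hA₀⟩ := Classical.choose_spec hex
      set j₀ := Classical.choose hex
      calc _ = ∏ c : Fin (2 * k + 1), (if c ∈ ySet k j₀ then brick A {c} else 1) := by
            refine Finset.prod_congr rfl (fun c _ => ?_)
            rw [anchorTerm_cubeBallTheta]
            refine if_congr ⟨fun hc => ?_, fun hc => Or.inr ⟨j₀, hj₀, hA₀, c, hc, rfl⟩⟩ rfl rfl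
            obtain ⟨j, hj, hAj, hcj⟩ := hsel A c hc hA2
            have : j = j₀ := hinj hj hj₀ (hAj.symm.trans hA₀)
            rwa [← this]
        _ = ∏ d ∈ ySet k j₀, brick A {d} := by
            rw [← Finset.prod_filter, Finset.filter_mem_eq_inter, Finset.univ_inter]
    · rw [dif_neg hex]
      refine Finset.prod_eq_one (fun c _ => ?_)
      rw [anchorTerm_cubeBallTheta, if_neg]
      intro hc
      obtain ⟨j, hj, hAj, -⟩ := hsel A c hc hA2
      exact hex ⟨j, hj, hAj⟩
  rw [Finset.prod_congr rfl hinner]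
  -- only the pairs `pr j` contribute
  rw [← Finset.prod_filter_mul_prod_filter_not (Finset.powersetCard 2 Finset.univ) (fun A => ∃ j ∈ Finset.range k, A = pr j)]
  rw [Finset.prod_congr rfl (fun A hA => dif_neg (Finset.mem_filter.mp hA).2) , Finset.prod_const_one, mul_one]
  have himg : (Finset.powersetCard 2 (Finset.univ : Finset (Fin (2 * k + 1)))).filter
      (fun A => ∃ j ∈ Finset.range k, A = pr j) = (Finset.range k).image pr := by
    ext A
    simp only [Finset.mem_filter, Finset.mem_powersetCard, Finset.subset_univ, true_and, Finset.mem_image]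
    constructor
    · rintro ⟨-, j, hj, rfl⟩; exact ⟨j, hj, rfl⟩
    · rintro ⟨j, hj, rfl⟩
      exact ⟨by rw [hpr, Finset.card_pair (vtx_two_mul_ne (Finset.mem_range.mp hj))], j, hj, rfl⟩
  rw [himg, Finset.prod_image hinj]
  refine Finset.prod_congr rfl (fun j hj => ?_)
  have hex : ∃ j' ∈ Finset.range k, pr j = pr j' := ⟨j, hj, rfl⟩
  rw [dif_pos hex]
  have : Classical.choose hex = j :=
    hinj (Classical.choose_spec hex).1 hj (Classical.choose_spec hex).2.symm
  rw [this]

/-- **The anchored door with the 0/1 weights IS the cube-versus-ball witness.** -/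
theorem anchoredDoor_eq_witness (k : ℕ) :
    anchoredDoor (cubeBallTheta k) (fun _ _ _ => 0) (fun _ _ _ => 0) = witness k k := by
  classical
  rw [anchoredDoor, prod_vertexAnchors, prod_vertexPairAnchors, prod_pairAnchors, mul_one, witness_eq_prod]
  have hblock : ∀ j, blockW k j = (brick {vtx k (2 * j)} {vtx k (2 * j)} * brick {vtx k (2 * j + 1)} {vtx k (2 * j + 1)}) *
      ∏ d ∈ ySet k j, brick {vtx k (2 * j), vtx k (2 * j + 1)} {d} := fun j => rfl
  simp_rw [hblock]
  rw [Finset.prod_mul_distrib, ← prod_range_two_mul (fun i => brick {vtx k i} {vtx k i}) k, xSet,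
    Finset.prod_image]
  intro i hi i' hi' hv
  exact vtx_inj (by have := Finset.mem_range.mp hi; omega) (by have := Finset.mem_range.mp hi'; omega) hv

/-- **The anchored door is alive on cube-versus-ball at every height.** For `k ≥ 1`, rows ranging injectively over the
subsets of the first `2k` `x`-vertices and columns containing the radius-`k` ball of `y`-subsets, SOME parameters make the
anchored door's layout matrix nonsingular — namely the 0/1 weights above (hard Lefschetz, `CubeBall.det_cubeBall_witness_ne_zero`). -/
theorem anchoredDoor_hits_cubeBall (k : ℕ) {r : ℕ} (u w : Fin r → Finset (Fin (2 * k + 1)))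
    (hu : Function.Injective u) (hur : ∀ i, vtx k (2 * k) ∉ u i)
    (hwr : ∀ T : Finset (Fin (2 * k + 1)), T.card ≤ k → T ∈ Set.range w) :
    ∃ (θ : Finset (Fin (2 * k + 1)) → Finset (Fin (2 * k + 1)) → ℂ)
      (φ ψ : Finset (Fin (2 * k + 1)) → Finset (Fin (2 * k + 1)) → Fin (2 * k + 1) → ℂ),
      (Matrix.of fun i j : Fin r => MvPolynomial.coeff
        (∑ a ∈ u i, Finsupp.single (Fin.castAdd (2 * k + 1) a) 1 +
          ∑ c ∈ w j, Finsupp.single (Fin.natAdd (2 * k + 1) c) 1) (anchoredDoor θ φ ψ)).det ≠ 0 := by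
  refine ⟨cubeBallTheta k, fun _ _ _ => 0, fun _ _ _ => 0, ?_⟩
  rw [anchoredDoor_eq_witness]
  exact det_cubeBall_witness_ne_zero k u w hu hur hwr

end

end Summit.ValiantsHypothesis.ValiantsHypothesis.Theorems.BarrierLever.AnchoredDoor
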